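/-
Copyright (c) 2026 the pub-hodgecm-mathlib formalisation cell (harness21).  Prover seat hodgecm-mathlib-F0P2-p07 (g0), strike line L1
`stub_firstTermThetaPairing` (LEAD F0P6-plan (g14) BATCH #64∕#68: «ramified `hmid` = F0P2-p07»): Track B «K2-LIT», hLiu418 = stmt-HodgeConjecture-24832, road `K2_Liu`,
socket #42S, organ S1 ROAD W, the RAMIFIED middle row: `P_Δ = N_Δ · M_Δ` IN THE ORDER OF ★ (C3) `K2LiuTensorMiddleCellLeviRow` AND `Ad(d_a)` ON IT (K2Lit CM letters).
-/
import Summits.HodgeConjecture.HodgeConjecture.Theorems.K2LiuLocalSWRamifiedLeviRowInvariance  -- ★ (this seat): `localCongr_dA_nElem`, `localCongr_dA_eq_self_of_blkB_eq_zero`, …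
import Summits.HodgeConjecture.HodgeConjecture.Theorems.K2LiuLeviDeltaDecomposition         -- ★ `exists_leviDeltaLoc_mul_unipDeltaLocal` (+ ★ `leviDeltaLoc`)
import Summits.HodgeConjecture.HodgeConjecture.Theorems.K2LiuUnipDeltaLocalCoordinates       -- ★ `eq_nElem_of_mem_unipDeltaLocal`, `skew_blkB_of_mem_unipDeltaLocal`
import HarnessLib

/-!
# Crux `HLiu418`, #42S organ S1, ROAD W, the RAMIFIED middle row: EVERY `x ∈ P_Δ` IS `n(t) · m` (UNIPOTENT FIRST, `m ∈ M_Δ`), AND `Ad(d_a)(n(t)·m) = n(a_v⁻¹t)·m`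

Cell `hodgecm-mathlib`, crux item hLiu418 = `stmt-HodgeConjecture-24832`; squad K2 ∕ K2Liu; LEAD F0P6-plan (g14); prover F0P2-p07 (g0).  THEOREMS ONLY (no `def`, no instance,
no notation, no named-fact hypothesis, no `sorry`); lane `--supports stmt-HodgeConjecture-24832 --as helper`.

WHY.  ★ (C3) `K2LiuTensorMiddleCellLeviRow.exists_ne_zero_swSectionTensorLoc_flip_mul_nElem_mul_eq_integral_levi` (p862499) reads the middle-cell value at
`w₁ · (n(t) · k)` — UNIPOTENT FIRST, `k` Siegel with a transported-Levi letter (paid for `k ∈ M_Δ = leviDeltaLoc` by (C3-b)); ★ (R-g) `exists_levi_mul_nElem` and my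
★ `K2LiuLocalSWRamifiedLeviRowInvariance` §5 are in the order `m · n(t)`.  THIS FILE supplies the K2Lit-CM twin in (C3)'s order, for the doubled group
`H_v = U(𝕍 ⊕ −𝕍)(L⁺_v)` of `hermD L e dV hdV dW hdW` (any `n`, any `T₀`-presentation `hJD`):
* §1 **`exists_nElem_mul_leviDeltaLoc`** — `x ∈ P_Δ ⇒ x = n(t) · m` with `m ∈ leviDeltaLoc` and `t = B(n)` skew (apply ★ `exists_leviDeltaLoc_mul_unipDeltaLocal` to `x⁻¹`
  and invert; ★ `eq_nElem_of_mem_unipDeltaLocal`);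
* §2 **`localCongr_dA_nElem_mul_leviDeltaLoc`** — `Ad(d_a)(n(t) · m) = n(a_v⁻¹•t) · m` for `m ∈ leviDeltaLoc` (★ `localCongr_dA_nElem_mul_levi`);
* §3 **`flip_mul_localCongr_dA_eq_of_unipScaling_levi`** — the `hd₁` row `∀ x ∈ P_Δ, F₀(w₁ · Ad_{d_a} x) = F₀(w₁ · x)` from the UNIT-SCALING invariance
  «`F₀(w₁·(n(a_v⁻¹•t)·m)) = F₀(w₁·(n(t)·m))` for `m ∈ M_Δ`, skew `t`» — the shape in which ★ (C3) + the factorisation deliver it;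
* §4 **`flip_mul_localCongr_dA_eq_of_levi_factorisation`** — the same from a TWO-LETTER FACTORISATION `F₀(w₁·(n(t)·m)) = K·G t m` with `G (a_v⁻¹•t) m = G t m`
  (the `hg` of the (M2b) evaluation, letters ★ `K2LiuNonsplitMiddleProfileRow` ∕ ★ `K2LiuNonsplitTracePhase.forall_tracePhase_mul_eq_one_iff`).
References: [Kudla1994] §3 Thm. 3.1; [HarrisKudlaSweet1996] §1 (1.11), (1.15); [MoeglinVignerasWaldspurger1987] Chap. 2 II.1; [MoeglinWaldspurger1995] II.1.6.
HONEST LABEL.  Count-neutral helper: `HC_CM` is proved only modulo the 7 printed citations (2 remaining named inputs: hLiu418 = `stmt-HodgeConjecture-24832`,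
h413 = `stmt-HodgeConjecture-24833`) until rung 0 closes.  NOT here: (C3) itself, the readings (C3-b…e), the evaluation, the face assembly.

## References
* [Kudla1994] S. S. Kudla, Israel J. Math. 87 (1994), §3 Thm. 3.1.
* [HarrisKudlaSweet1996] M. Harris, S. Kudla, W. J. Sweet, J. Amer. Math. Soc. 9 (1996), §1 (1.11), (1.15).
* [MoeglinVignerasWaldspurger1987] C. Mœglin, M.-F. Vignéras, J.-L. Waldspurger, LNM 1291 (1987), Chap. 2 II.1.
* [MoeglinWaldspurger1995] C. Mœglin, J.-L. Waldspurger, *Spectral Decomposition and Eisenstein Series* (1995), II.1.6.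
-/

set_option autoImplicit false
set_option linter.dupNamespace false -- the mandated namespace repeats `HodgeConjecture.HodgeConjecture`

noncomputable section

open scoped Matrix
open NumberField IsDedekindDomain Matrix
open Literature.NumberTheory.Automorphic Literature.NumberTheory.Automorphic.UnitaryGroup Literature.NumberTheory.Weil1964
open Literature.NumberTheory.GelbartRogawski1991 Literature.NumberTheory.GelbartRogawski1991.GRConstruction
open Literature.NumberTheory.GelbartRogawski1991.AdaptedBlocks
open Literature.NumberTheory.GelbartRogawski1991.UnitaryDualPair
open Literature.NumberTheory.GelbartRogawski1991.UnitaryDualPair.LocalSplitting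
open Literature.NumberTheory.K2Lit.LocalSiegelDoubled
open Summit.HodgeConjecture.HodgeConjecture.Cruxes.HLiu418.K2LiuA7ValueInstanceDefs
open Summit.HodgeConjecture.HodgeConjecture.Cruxes.HLiu418.K2LiuLeviDeltaDecomposition
open Summit.HodgeConjecture.HodgeConjecture.Cruxes.HLiu418.K2LiuUnipDeltaLocalCoordinates
open Summit.HodgeConjecture.HodgeConjecture.Cruxes.HLiu418.K2LiuLocalSWRamifiedLeviRowInvariance
open Summit.HodgeConjecture.HodgeConjecture.Cruxes.HLiu418.K2LiuSkewPairingNondegeneracy (smul_skew)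

namespace Summit.HodgeConjecture.HodgeConjecture.Cruxes.HLiu418.K2LiuLocalSWRamifiedLeviRowInvarianceCM

variable (L : Type) [Field L] [NumberField L] [IsCMField L] [Algebra.IsQuadraticExtension (Fp L) L]
  {δ : L} (hcδ : IsCMField.complexConj L δ = -δ) (hδ : δ ≠ 0) {d : Fp L} (hd : δ * δ = algebraMap (Fp L) L d)
variable {N M n : ℕ} (e : Fin N × Fin M ≃ Fin n)
  (dV : Fin N → L) (hdV : ∀ i, IsCMField.complexConj L (dV i) = dV i)
  (dW : Fin M → L) (hdW : ∀ i, IsCMField.complexConj L (dW i) = dW i)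
  (v : HeightOneSpectrum (𝓞 (Fp L)))
  {T₀ : Matrix (Fin n) (Fin n) (Fp L)} (hT₀ : T₀.IsSymm)
  (hJD : hermD L e dV hdV dW hdW = (gramD (Fp L) n T₀).map (algebraMap (Fp L) L))
  (a : (Fp L)ˣ) {D₀ : GL (Fin (n + n)) (Fp L)}
  (hD₀ : (D₀ : Matrix (Fin (n + n)) (Fin (n + n)) (Fp L)) =
    Matrix.reindex (LocalSplitting.e₂ n) (LocalSplitting.e₂ n) (cayR (Fp L) (Fin n) * Matrix.fromBlocks 1 0 0 ((a : Fp L) • (1 : Matrix (Fin n) (Fin n) (Fp L))) * cayRinv (Fp L) (Fin n)))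
  {DA : GL (Fin (n + n)) L} (hDA : DA = Matrix.GeneralLinearGroup.map (algebraMap (Fp L) L) D₀)
  {b : L} (hb : b ≠ 0) (hDAJ : formCongr ((IsCMField.complexConj L : L ≃ₐ[Fp L] L) : L →+* L) DA (b • hermD L e dV hdV dW hdW) = hermD L e dV hdV dW hdW)

/-! ## §1 `P_Δ = N_Δ · M_Δ`, unipotent first -/

include hcδ hδ hd hT₀ in
set_option maxHeartbeats 400000 in -- MEASURED: 200000 times out at `whnf` (the `Group ↥H_v` instance paths behind `x⁻¹⁻¹ = (m·u)⁻¹` at the K2Lit CM letters); 400000 passes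
/-- **EVERY `x ∈ P_Δ` IS `n(t) · m`** with `m ∈ M_Δ = leviDeltaLoc` and `t = B(n)` skew: write `x⁻¹ = m′ · u` (★ `exists_leviDeltaLoc_mul_unipDeltaLocal`), so
`x = u⁻¹ · m′⁻¹` with `u⁻¹ ∈ N_Δ` (a subgroup), `u⁻¹ = n(B(u⁻¹))` (★ `eq_nElem_of_mem_unipDeltaLocal`), `m′⁻¹ ∈ M_Δ`.
[cite: HarrisKudlaSweet1996, §1 (1.11)] [cite: MoeglinWaldspurger1995, II.1.6] -/
theorem exists_nElem_mul_leviDeltaLoc {x : UnitaryGroup.localPi L (IsCMField.complexConj L) (n + n) (hermD L e dV hdV dW hdW) v}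
    (hx : IsSiegelDelta (Fp L) L (IsCMField.complexConj L) hcδ hδ hd v n hT₀ hJD x) :
    ∃ m ∈ leviDeltaLoc L e dV hdV dW hdW v, ∃ (t : Matrix (Fin n) (Fin n) (LocalRing L v))
      (ht : (t.map (conjLocal L (IsCMField.complexConj L) v))ᵀ * gramS (Fp L) L v n T₀ + gramS (Fp L) L v n T₀ * t = 0),
      x = nElem (Fp L) L (IsCMField.complexConj L) v n hJD t ht * m := by
  have hx' : IsSiegelDelta (Fp L) L (IsCMField.complexConj L) hcδ hδ hd v n hT₀ hJD x⁻¹ := hx.inv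
  obtain ⟨m, hm, u, hu, hxu⟩ := exists_leviDeltaLoc_mul_unipDeltaLocal L hcδ hδ hd e dV hdV dW hdW v hT₀ hJD hx'
  have hui : u⁻¹ ∈ unipDeltaLocal (Fp L) L (IsCMField.complexConj L) v n (JD := hermD L e dV hdV dW hdW) := inv_mem hu
  refine ⟨m⁻¹, inv_mem hm, blkB (matA (Fp L) L (IsCMField.complexConj L) v n u⁻¹),
    skew_blkB_of_mem_unipDeltaLocal (Fp L) L (IsCMField.complexConj L) v n hJD hui, ?_⟩
  have h1 := eq_nElem_of_mem_unipDeltaLocal (Fp L) L (IsCMField.complexConj L) v n hJD hui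
  have h2 : x⁻¹⁻¹ = (m * u)⁻¹ := by rw [hxu]
  rw [inv_inv x, _root_.mul_inv_rev m u] at h2
  rw [h2, ← h1]

/-! ## §2 `Ad(d_a)` on `n(t) · m` -/

omit [Algebra.IsQuadraticExtension (Fp L) L] in
include hD₀ hDA in
/-- **`Ad(d_a)(n(t) · m) = n(a_v⁻¹•t) · m`** for `m ∈ M_Δ` (★ `localCongr_dA_nElem_mul_levi` with the `leviDeltaLoc` letters). [cite: Kudla1994, §3] [cite: HarrisKudlaSweet1996, §1 (1.11)] -/
theorem localCongr_dA_nElem_mul_leviDeltaLoc {m : UnitaryGroup.localPi L (IsCMField.complexConj L) (n + n) (hermD L e dV hdV dW hdW) v}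
    (hm : m ∈ leviDeltaLoc L e dV hdV dW hdW v) {t : Matrix (Fin n) (Fin n) (LocalRing L v)}
    (ht : (t.map (conjLocal L (IsCMField.complexConj L) v))ᵀ * gramS (Fp L) L v n T₀ + gramS (Fp L) L v n T₀ * t = 0) :
    localCongr L (IsCMField.complexConj L) DA hb hDAJ v (nElem (Fp L) L (IsCMField.complexConj L) v n hJD t ht * m) =
      nElem (Fp L) L (IsCMField.complexConj L) v n hJD (toLocalRing L v (((a⁻¹ : (Fp L)ˣ) : Fp L) : v.adicCompletion (Fp L)) • t)
        (smul_skew (Fp L) L (IsCMField.complexConj L) v (((a⁻¹ : (Fp L)ˣ) : Fp L) : v.adicCompletion (Fp L)) ht) * m :=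
  localCongr_dA_nElem_mul_levi (Fp L) L (IsCMField.complexConj L) v n hJD a hD₀ hDA hb hDAJ m hm.1 hm.2 ht

/-! ## §3 The `hd₁` row from unit-scaling invariance, unipotent-first order -/

include hcδ hδ hd hT₀ hD₀ hDA in
set_option maxHeartbeats 400000 in -- MEASURED: 200000 times out at `whnf` (the `subst` + `rw` through the K2Lit CM doubled-group letters); 400000 passes
/-- **THE DILATION ROW FROM UNIT-SCALING INVARIANCE, ORDER `n(t) · m`**: if `F₀(w₁·(n(a_v⁻¹•t)·m)) = F₀(w₁·(n(t)·m))` for every `m ∈ M_Δ` and every skew `t`, then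
`F₀(w₁ · Ad_{d_a} x) = F₀(w₁ · x)` for every `x ∈ P_Δ` — the `hd₁` row of ★ `K2LiuLocalSWSpanningRamified` ∕ the conclusion of ★ p862306's `hmid`, for ANY `F₀`, `w₁`.
[cite: Kudla1994, §3 Thm. 3.1] [cite: HarrisKudlaSweet1996, §1 (1.15)] [cite: MoeglinVignerasWaldspurger1987, Chap. 2 II.1] -/
theorem flip_mul_localCongr_dA_eq_of_unipScaling_levi {X : Type*} (F₀ : UnitaryGroup.localPi L (IsCMField.complexConj L) (n + n) (hermD L e dV hdV dW hdW) v → X)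
    (w₁ : UnitaryGroup.localPi L (IsCMField.complexConj L) (n + n) (hermD L e dV hdV dW hdW) v)
    (h : ∀ m ∈ leviDeltaLoc L e dV hdV dW hdW v, ∀ (t : Matrix (Fin n) (Fin n) (LocalRing L v))
      (ht : (t.map (conjLocal L (IsCMField.complexConj L) v))ᵀ * gramS (Fp L) L v n T₀ + gramS (Fp L) L v n T₀ * t = 0),
      F₀ (w₁ * (nElem (Fp L) L (IsCMField.complexConj L) v n hJD (toLocalRing L v (((a⁻¹ : (Fp L)ˣ) : Fp L) : v.adicCompletion (Fp L)) • t)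
        (smul_skew (Fp L) L (IsCMField.complexConj L) v (((a⁻¹ : (Fp L)ˣ) : Fp L) : v.adicCompletion (Fp L)) ht) * m)) =
        F₀ (w₁ * (nElem (Fp L) L (IsCMField.complexConj L) v n hJD t ht * m))) :
    ∀ x, IsSiegelDelta (Fp L) L (IsCMField.complexConj L) hcδ hδ hd v n hT₀ hJD x →
      F₀ (w₁ * localCongr L (IsCMField.complexConj L) DA hb hDAJ v x) = F₀ (w₁ * x) := by
  intro x hx
  obtain ⟨m, hm, t, ht, rfl⟩ := exists_nElem_mul_leviDeltaLoc L hcδ hδ hd e dV hdV dW hdW v hT₀ hJD hx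
  rw [localCongr_dA_nElem_mul_leviDeltaLoc L e dV hdV dW hdW v hJD a hD₀ hDA hb hDAJ hm ht]
  exact h m hm t ht

/-! ## §4 The `hd₁` row from a two-letter factorisation with a unit-invariant profile -/

include hcδ hδ hd hT₀ hD₀ hDA in
/-- **THE DILATION ROW FROM A FACTORISATION `F₀(w₁·(n(t)·m)) = K · G t m` WITH `G (a_v⁻¹•t) m = G t m`** (`m ∈ M_Δ`, `t` skew; `G` = the (M2b) profile
`c(m)·μ(B_m)μ(U_m)μ(C_m)·𝟙[Q_{t,m}]`, whose only `t`-dependence is the ball-triviality letter `Q`, unit-invariant by ★ `forall_tracePhase_mul_eq_one_iff`):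
`F₀(w₁ · Ad_{d_a} x) = F₀(w₁ · x)` on `P_Δ`. [cite: Kudla1994, §3 Thm. 3.1] [cite: HarrisKudlaSweet1996, §1 (1.15)] -/
theorem flip_mul_localCongr_dA_eq_of_levi_factorisation (F₀ : UnitaryGroup.localPi L (IsCMField.complexConj L) (n + n) (hermD L e dV hdV dW hdW) v → ℂ)
    (w₁ : UnitaryGroup.localPi L (IsCMField.complexConj L) (n + n) (hermD L e dV hdV dW hdW) v) (K : ℂ)
    (G : Matrix (Fin n) (Fin n) (LocalRing L v) → UnitaryGroup.localPi L (IsCMField.complexConj L) (n + n) (hermD L e dV hdV dW hdW) v → ℂ)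
    (hfac : ∀ m ∈ leviDeltaLoc L e dV hdV dW hdW v, ∀ (t : Matrix (Fin n) (Fin n) (LocalRing L v))
      (ht : (t.map (conjLocal L (IsCMField.complexConj L) v))ᵀ * gramS (Fp L) L v n T₀ + gramS (Fp L) L v n T₀ * t = 0),
      F₀ (w₁ * (nElem (Fp L) L (IsCMField.complexConj L) v n hJD t ht * m)) = K * G t m)
    (hG : ∀ m ∈ leviDeltaLoc L e dV hdV dW hdW v, ∀ (t : Matrix (Fin n) (Fin n) (LocalRing L v)),
      (t.map (conjLocal L (IsCMField.complexConj L) v))ᵀ * gramS (Fp L) L v n T₀ + gramS (Fp L) L v n T₀ * t = 0 →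
      G (toLocalRing L v (((a⁻¹ : (Fp L)ˣ) : Fp L) : v.adicCompletion (Fp L)) • t) m = G t m) :
    ∀ x, IsSiegelDelta (Fp L) L (IsCMField.complexConj L) hcδ hδ hd v n hT₀ hJD x →
      F₀ (w₁ * localCongr L (IsCMField.complexConj L) DA hb hDAJ v x) = F₀ (w₁ * x) :=
  flip_mul_localCongr_dA_eq_of_unipScaling_levi L hcδ hδ hd e dV hdV dW hdW v hT₀ hJD a hD₀ hDA hb hDAJ F₀ w₁ fun m hm t ht => by
    rw [hfac m hm _ _, hfac m hm t ht, hG m hm t ht]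

end Summit.HodgeConjecture.HodgeConjecture.Cruxes.HLiu418.K2LiuLocalSWRamifiedLeviRowInvarianceCM

end
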